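import Summits.PneNP.PneNP.Theorems.SmallBlockRothvossBallGridBound
import Literature.Barriers.PneNP.TSPExtensionComplexityMatchingFace
import HarnessLib

/-!
# Block-diagonal psd lifts of the travelling salesman polytope (cell pnp-psdrank, eng g5)

The cell's block bound for the perfect matching polytope
(`Summit.PneNP.PneNP.Theorems.SmallBlockRothvossBallGrid.blockPsd_largeBlocks`: for even `n ≥ n₀`,
`1 ≤ b ≤ n`, every `(S^b_+)^m` factorization of the odd-cut slack matrix of `P_PM(n)` has
`2^{c n/(b+1)} ≤ m · n⁹`) transported to `TSP(3n + pad)` through Yannakakis' face, in the slack form already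
in the tree (`Literature.Barriers.PneNP.exists_matching_slack_data`: points `v_M ∈ TSP(3n + pad)` and valid
inequalities `c_U · x ≤ d_U` with slacks `d_U − c_U · v_M = |δ(U) ∩ M| − 1`
[cite: Yannakakis1991, Thm. 2] [cite: Rothvoss2017, Cor. 2 (PDF p. 4)]):

* `tsp_blockPsd` — for even `n ≥ n₀`, every `pad`, `1 ≤ b ≤ n`: if the FULL slack matrix of `TSP(3n + pad)`
  (rows = all valid inequalities `c · x ≤ δ` on `tspPolytope (3n + pad)`, columns = all its points) is
  `Σ_{k<m} tr(U^k V^k)` with psd `b × b` blocks, then `2^{c n/(b+1)} ≤ m · n⁹` (`c = δ_R/798`);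
* `tsp_blockPsd_cities` — the same indexed by the number of cities: for all `N ≥ N₀` and `1 ≤ b ≤ N/3 − 2`,
  `2^{c (N/3 − 2)/(b+1)} ≤ m · N⁹`.

By the cone factorization theorem this says: an `(S^b_+)^m`-lift (block-diagonal SDP extended formulation
with `m` blocks of size `b`) of the TSP polytope on `N` cities needs `m ≥ 2^{Ω(N/(b+1))}/N⁹` blocks — the
Rothvoß-strength exponent; via the correlation polytope one only gets `2^{Ω(√N/(b+1))}`
(`SupportRectangleBlockLiftUDISJ`, cf. [cite: FawziParrilo2013, Thm. 1 and §1 (TSP remark)]).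
WHAT THIS IS NOT: not a bound on general psd rank / SDP extension complexity of TSP (that is
Lee–Raghavendra–Steurer's `2^{Ω(N^{1/13})}`, not in the tree); exact lifts only; nothing P ≠ NP-relevant.
-/

set_option linter.dupNamespace false -- `Summit.PneNP.PneNP.…`: summit = sub-problem (D-0017)

noncomputable section

open scoped Classical MatrixOrder

open Finset Real Matrix Literature.Barriers.PneNP Literature.Combinatorics.Optimization

namespace Summit.PneNP.PneNP.Theorems.SmallBlockRothvossBallGrid

/-- **Restriction of a block psd factorization of the full slack matrix of `TSP(3n + pad)` to Yannakakis'
matching face** gives a block psd factorization of the odd-cut slack matrix of `P_PM(n)`.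
[cite: Yannakakis1991, Thm. 2] [cite: Rothvoss2017, Cor. 2 (PDF p. 4)] -/
theorem hasBlockPsdFactorization_of_tsp {n pad b m : ℕ} (hn : 0 < n)
    (U : {cd : ((⊤ : SimpleGraph (Fin (3 * n + pad))).edgeSet → ℝ) × ℝ //
            ∀ x ∈ tspPolytope (3 * n + pad), cd.1 ⬝ᵥ x ≤ cd.2} → Fin m → Matrix (Fin b) (Fin b) ℝ)
    (V : {x : (⊤ : SimpleGraph (Fin (3 * n + pad))).edgeSet → ℝ // x ∈ tspPolytope (3 * n + pad)} →
      Fin m → Matrix (Fin b) (Fin b) ℝ)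
    (hU : ∀ cd k, (U cd k).PosSemidef) (hV : ∀ x k, (V x k).PosSemidef)
    (hfac : ∀ cd x, cd.1.2 - cd.1.1 ⬝ᵥ x.1 = ∑ k, (U cd k * V x k).trace) :
    HasBlockPsdFactorization n b m := by
  obtain ⟨v, c, d, hv, hc, hslack⟩ := exists_matching_slack_data n pad hn
  rw [hasBlockPsdFactorization_iff]
  refine ⟨fun M k => (V ⟨v M, hv M⟩ k)ᵀ, fun W k => (U ⟨(c W, d W), hc W⟩ k)ᵀ,
    fun M k => (hV _ k).transpose, fun W k => (hU _ k).transpose, fun W M => ?_⟩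
  rw [pmOddCutSlack_apply, cc]
  have h1 := hslack W M
  have h2 := hfac ⟨(c W, d W), hc W⟩ ⟨v M, hv M⟩
  simp only at h2
  rw [← h1, h2]
  refine sum_congr rfl fun k _ => ?_
  rw [← transpose_mul, trace_transpose]

/-- **Block-diagonal psd lifts of `TSP(3n + pad)`.** There are `c > 0` (`= δ_R/798`) and `n₀` such that for
every even `n ≥ n₀`, every `pad`, every block size `1 ≤ b ≤ n` and every `m`: if the full slack matrix of
the TSP polytope on `3n + pad` cities — rows all valid inequalities `c · x ≤ δ`, columns all points of
`tspPolytope (3n + pad)` — equals `Σ_{k<m} tr(U^k V^k)` with psd `b × b` blocks `U^k, V^k`, then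
`2^{c n/(b+1)} ≤ m · n⁹`. [cite: Rothvoss2017, Cor. 2 (PDF p. 4)] [cite: Yannakakis1991, Thm. 2] -/
theorem tsp_blockPsd : ∃ c : ℝ, 0 < c ∧ ∃ n₀ : ℕ, ∀ n : ℕ, n₀ ≤ n → Even n → ∀ pad b m : ℕ,
    1 ≤ b → b ≤ n →
    (∀ (U : {cd : ((⊤ : SimpleGraph (Fin (3 * n + pad))).edgeSet → ℝ) × ℝ //
              ∀ x ∈ tspPolytope (3 * n + pad), cd.1 ⬝ᵥ x ≤ cd.2} → Fin m → Matrix (Fin b) (Fin b) ℝ)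
      (V : {x : (⊤ : SimpleGraph (Fin (3 * n + pad))).edgeSet → ℝ // x ∈ tspPolytope (3 * n + pad)} →
        Fin m → Matrix (Fin b) (Fin b) ℝ),
      (∀ cd k, (U cd k).PosSemidef) → (∀ x k, (V x k).PosSemidef) →
      (∀ cd x, cd.1.2 - cd.1.1 ⬝ᵥ x.1 = ∑ k, (U cd k * V x k).trace) →
        (2 : ℝ) ^ (c * n / (b + 1)) ≤ m * (n : ℝ) ^ 9) := by
  obtain ⟨c, hc, n₀, h⟩ := blockPsd_largeBlocks
  refine ⟨c, hc, max n₀ 1, fun n hn heven pad b m hb hbn U V hU hV hfac => ?_⟩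
  have hn0 : 0 < n := lt_of_lt_of_le one_pos (le_trans (le_max_right _ _) hn)
  exact h n (le_trans (le_max_left _ _) hn) heven b m hb hbn
    (hasBlockPsdFactorization_of_tsp hn0 U V hU hV hfac)

/-- **Block-diagonal psd lifts of `TSP(N)`, indexed by the number of cities.** There are `c > 0` and `N₀`
such that for all `N ≥ N₀`, all block sizes `1 ≤ b` with `b + 2 ≤ N/3`, and all `m`: a psd factorization of
the full slack matrix of `tspPolytope N` through `m` blocks of size `b` forces
`2^{c (N/3 − 2)/(b+1)} ≤ m · N⁹`; i.e. an `(S^b_+)^m`-lift of the TSP polytope on `N` cities has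
`m ≥ 2^{Ω(N/(b+1))}/N⁹`, and one with polynomially many blocks has a block of dimension `Ω(N/log N)`.
[cite: Rothvoss2017, Cor. 2 (PDF p. 4)] [cite: FawziParrilo2013, Thm. 1 (the `2^{Ω(√N)}`-type COR route)] -/
theorem tsp_blockPsd_cities : ∃ c : ℝ, 0 < c ∧ ∃ N₀ : ℕ, ∀ N : ℕ, N₀ ≤ N → ∀ b m : ℕ,
    1 ≤ b → (b : ℝ) + 2 ≤ (N : ℝ) / 3 →
    (∀ (U : {cd : ((⊤ : SimpleGraph (Fin N)).edgeSet → ℝ) × ℝ //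
              ∀ x ∈ tspPolytope N, cd.1 ⬝ᵥ x ≤ cd.2} → Fin m → Matrix (Fin b) (Fin b) ℝ)
      (V : {x : (⊤ : SimpleGraph (Fin N)).edgeSet → ℝ // x ∈ tspPolytope N} →
        Fin m → Matrix (Fin b) (Fin b) ℝ),
      (∀ cd k, (U cd k).PosSemidef) → (∀ x k, (V x k).PosSemidef) →
      (∀ cd x, cd.1.2 - cd.1.1 ⬝ᵥ x.1 = ∑ k, (U cd k * V x k).trace) →
        (2 : ℝ) ^ (c * ((N : ℝ) / 3 - 2) / (b + 1)) ≤ m * (N : ℝ) ^ 9) := by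
  obtain ⟨c, hc, n₀, h⟩ := tsp_blockPsd
  refine ⟨c, hc, 3 * n₀ + 6, fun N hN b m hb hbN U V hU hV hfac => ?_⟩
  -- the even number `n = 2 ⌊N/6⌋` with `N/3 - 2 ≤ n ≤ N/3`, and `pad = N - 3n`
  set n : ℕ := 2 * (N / 6) with hn
  have heven : Even n := ⟨N / 6, by rw [hn]; ring⟩
  have h3n : 3 * n ≤ N := by rw [hn]; omega
  have hn₀ : n₀ ≤ n := by rw [hn]; omega
  have hNreal : (N : ℝ) / 3 - 2 ≤ n := by
    have h1 : N < 6 * (N / 6) + 6 := by omega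
    have h2 : (N : ℝ) < 6 * ((N / 6 : ℕ) : ℝ) + 6 := by exact_mod_cast h1
    have h3 : (n : ℝ) = 2 * ((N / 6 : ℕ) : ℝ) := by rw [hn]; push_cast; ring
    rw [h3]
    linarith
  have hnN : (n : ℝ) ≤ N := by
    have : n ≤ N := le_trans (Nat.le_mul_of_pos_left n (by norm_num : 0 < 3)) h3n
    exact_mod_cast this
  have hbn : b ≤ n := by
    have : (b : ℝ) ≤ n := by linarith
    exact_mod_cast this
  -- transport the data along `Fin (3n + (N - 3n)) = Fin N`
  have hN3 : 3 * n + (N - 3 * n) = N := by omega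
  have key : ∀ (N' : ℕ) (hNN : N' = N)
      (U' : {cd : ((⊤ : SimpleGraph (Fin N')).edgeSet → ℝ) × ℝ //
              ∀ x ∈ tspPolytope N', cd.1 ⬝ᵥ x ≤ cd.2} → Fin m → Matrix (Fin b) (Fin b) ℝ)
      (V' : {x : (⊤ : SimpleGraph (Fin N')).edgeSet → ℝ // x ∈ tspPolytope N'} →
        Fin m → Matrix (Fin b) (Fin b) ℝ),
      (∀ cd k, (U' cd k).PosSemidef) → (∀ x k, (V' x k).PosSemidef) →
      (∀ cd x, cd.1.2 - cd.1.1 ⬝ᵥ x.1 = ∑ k, (U' cd k * V' x k).trace) →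
      N' = 3 * n + (N - 3 * n) → (2 : ℝ) ^ (c * n / (b + 1)) ≤ m * (n : ℝ) ^ 9 := by
    intro N' _ U' V' hU' hV' hfac' hN'
    subst hN'
    exact h n hn₀ heven (N - 3 * n) b m hb hbn U' V' hU' hV' hfac'
  have main := key N rfl U V hU hV hfac hN3.symm
  -- monotonicity in `n`
  have hb1 : (0 : ℝ) < (b : ℝ) + 1 := by positivity
  have hexp : c * ((N : ℝ) / 3 - 2) / (b + 1) ≤ c * n / (b + 1) := by
    rw [div_le_div_iff_of_pos_right hb1]
    exact mul_le_mul_of_nonneg_left hNreal hc.le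
  calc (2 : ℝ) ^ (c * ((N : ℝ) / 3 - 2) / (b + 1)) ≤ (2 : ℝ) ^ (c * n / (b + 1)) :=
        Real.rpow_le_rpow_of_exponent_le (by norm_num) hexp
    _ ≤ m * (n : ℝ) ^ 9 := main
    _ ≤ m * (N : ℝ) ^ 9 :=
        mul_le_mul_of_nonneg_left (pow_le_pow_left₀ (Nat.cast_nonneg n) hnN 9) (Nat.cast_nonneg m)

end Summit.PneNP.PneNP.Theorems.SmallBlockRothvossBallGrid

end
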